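import Summits.NavierStokesRegularity.NavierStokesRegularity.Theorems.SymmetryModuliCountAxisymEndLiouvilleStubWeightProfile
import Summits.NavierStokesRegularity.NavierStokesRegularity.Theorems.SymmetryModuliCountAxisymEndLiouvilleStubSwirlComparison
import Summits.NavierStokesRegularity.NavierStokesRegularity.Theorems.SymmetryModuliCountAxisymEndLiouvilleStubNoSwirlLiouville
import Summits.NavierStokesRegularity.NavierStokesRegularity.Theorems.SymmetryModuliCountSymmetricLiouvilleRotationCovariance
import Summits.NavierStokesRegularity.NavierStokesRegularity.Theorems.ExtremiserTransienceNearExtremalTransiencePerFlowEternalSymmetry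
import Summits.NavierStokesRegularity.NavierStokesRegularity.Theorems.ExtremiserTransienceMemberSelection
import Literature.Analysis.FluidPDE.TypeIAncientMildRescale
import HarnessLib

/-!
# Axisymmetric Type-I ancient mild fields vanish — rung R5″ of LINE g9-β `filament_selection` (crux 26567), BY NAME

Helper file for the crux `NearExtremalTransiencePerFlow` (stmt-NavierStokesRegularity-26567), LINE g9-β `filament_selection`
(workfile `Cruxes/NearExtremalTransiencePerFlow/Lines/filament_selection.lean`), necklace brief item (f) / rung R5.

The workfile's rung R5 `AxisymmetricTubeLiouville` (rev 10) and the landed single-slice form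
`NearExtremalTransiencePerFlow.FilamentSelection.eq_zero_of_isAxisymmetric_slice` (this namespace, file `…EternalSymmetry`) kill
AXISYMMETRIC Type-I ancient mild fields under the EXTRA decay hypothesis `∃ C, ∀ τ < 0, ∀ x, r‖W τ x‖ ≤ C` (placement onto KNSS 2009
Thm 5.3, `knss_bound_C_over_r_holds`).  That hypothesis is IDLE: the crux `AxisymEndLiouville` of route SymmetryModuliCount
(stmt-NavierStokesRegularity-14061) is CLOSED — `Summit.NavierStokesRegularity.NavierStokesRegularity.Theorems.AxisymEndLiouville_of`,
line «absorbing-axis-swirl-extinction» — and its landed pipeline proves that EVERY axisymmetric element of the Type-I ancient mild class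
`𝒜_C` (`IsTypeIAncientMild C W`) vanishes, with no decay and no growth hypothesis:

1. `AxisymEndLiouville.AbsorbingAxisSwirlExtinction.stub_swirlWeightProfile` — an explicit weight `w` with
   `w'' − (ρ/2 + 1/ρ − C) w' + λ w ≤ 0`, `λ > 0`, `ρ ≤ K w(ρ)`;
2. `….stub_swirlComparison` — the weighted maximum principle for the swirl `Γ = r u_θ` (KNSS 2009 (1.8)):
   `|Γ(t,x)| ≤ C K (t/t')^λ w(r/√(−t))` for all `t' < t < 0`; `t' → −∞` kills the swirl;
3. `….stub_noSwirlLiouville` — KNSS 2009 Thm 5.2 (`knss_axisymmetric_no_swirl_holds`) on the bounded time shifts.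

This file cites that pipeline BY NAME (import-never-restate) in the integrated vocabulary `IsAxisymmetric (W τ)` of the filament
line, and records the corollaries the necklace brief consumes:

* `hasNoSwirl_of_isAxisymmetric`, `eq_zero_of_isAxisymmetric` — all slices axisymmetric (about the `x₃`-axis) ⇒ `W ≡ 0`;
* `eq_zero_of_isAxisymmetric_oneSlice` — ONE axisymmetric slice suffices (eternal symmetry, `isAxisymmetric_of_isAxisymmetric_slice`);
* `eq_zero_of_conj_isAxisymmetric`, `eq_zero_of_conj_isAxisymmetric_oneSlice` — ANY axis `{L (s e₃) + b}` (conjugation covariance of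
  `𝒜_C`: `isTypeIAncientMild_conj_linearIsometryEquiv`, `IsTypeIAncientMild.comp_add_right`);
* `not_isTubeSlice_of_isAxisymmetric`, `not_isTubeSlice_of_isAxisymmetric_oneSlice`, `not_isTubeSlice_of_conj_isAxisymmetric_oneSlice`
  — the axisymmetric case of the heart H′ `NoFilamentTubeSliceAllTime` with NO decay and NO growth hypothesis: a counterexample to H′
  (a Type-I ancient necklace) has no slice axisymmetric about any axis.

HONEST FRAMING: Liouville-type bookkeeping about hypothetical Type-I ancient fields, assembled from landed theorems of another route's
cone; nothing about Navier–Stokes regularity or blow-up is proved; H′ and the crux 26567 stay OPEN; no summit is proved by a line.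
[cite: KochNadirashviliSereginSverak2009, (1.8) and Thm 5.2 (arXiv:0709.3599 §1, §5)]
-/

noncomputable section

open scoped Topology
open MeasureTheory Filter Set Function Metric
open Literature.Analysis Literature.Analysis.FluidPDE
open Summit.NavierStokesRegularity.NavierStokesRegularity.Theorems.AxisymEndLiouville.AbsorbingAxisSwirlExtinction
open Summit.NavierStokesRegularity.NavierStokesRegularity.Theorems.SymmetryModuliCountSymmetricLiouville
open Summit.NavierStokesRegularity.NavierStokesRegularity.Theorems.NearExtremalTransiencePerFlow.MemberSelection

namespace Summit.NavierStokesRegularity.NavierStokesRegularity.Theorems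

set_option linter.dupNamespace false

namespace NearExtremalTransiencePerFlow.FilamentSelection

/-! ### All slices axisymmetric about the `x₃`-axis -/

/-- **Swirl extinction.**  An axisymmetric Type-I ancient mild field is swirl free at every negative time: the weighted maximum
principle `|Γ(t,x)| ≤ C K (t/t')^λ w(r/√(−t))` of the landed `stub_swirlComparison` (weight from `stub_swirlWeightProfile`) and
`t' → −∞`.  Steps 2–4 of the closed crux `AxisymEndLiouville` (stmt-14061), by name.
[cite: KochNadirashviliSereginSverak2009, (1.8) (arXiv:0709.3599 §1)] -/
theorem hasNoSwirl_of_isAxisymmetric {K : ℝ} {W : ℝ → EuclideanSpace ℝ (Fin 3) → EuclideanSpace ℝ (Fin 3)}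
    (hW : IsTypeIAncientMild K W) (hax : ∀ τ : ℝ, τ < 0 → IsAxisymmetric (W τ)) :
    ∀ τ : ℝ, τ < 0 → HasNoSwirl (W τ) := by
  -- adapted verbatim from the assembly `AxisymEndLiouville_of` (Theorems/SymmetryModuliCountAxisymEndLiouville.lean)
  have hK : 0 ≤ K := hW.nonneg
  obtain ⟨lam, K', hlam, hK', w, hwc, hw2, hw0, hwK, hw1, hwineq⟩ := stub_swirlWeightProfile K hK
  intro t ht y
  refine abs_nonpos_iff.1 (le_of_forall_pos_le_add fun η hη => ?_)
  -- a past time `t' < t` with `a (t/t')^λ ≤ η`, `a = K K' w(r/√(-t))` (`(t/t')^λ → 0` as `t' → -∞`; the computation of the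
  -- assembly `AxisymEndLiouville_of`, inlined)
  obtain ⟨t', ht', hle⟩ : ∃ t' : ℝ, t' < t ∧
      K * K' * w (cylRadius y / Real.sqrt (-t)) * (t / t') ^ lam ≤ η := by
    set a : ℝ := K * K' * w (cylRadius y / Real.sqrt (-t)) with ha
    have h1 : Tendsto (fun T : ℝ => T ^ (-lam)) atTop (𝓝 0) := tendsto_rpow_neg_atTop hlam
    have h2 : Tendsto (fun T : ℝ => a * (-t) ^ lam * T ^ (-lam)) atTop (𝓝 0) := by
      simpa using h1.const_mul (a * (-t) ^ lam)
    have h3 : ∀ᶠ T in atTop, a * (-t) ^ lam * T ^ (-lam) ≤ η := h2.eventually (ge_mem_nhds hη)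
    obtain ⟨T, hTη, hTgt⟩ := (h3.and (eventually_gt_atTop (max (-t) 0))).exists
    have hT0 : 0 < T := lt_of_le_of_lt (le_max_right _ _) hTgt
    refine ⟨-T, by linarith [le_max_left (-t) 0], ?_⟩
    have e : (t / -T) = (-t) * T⁻¹ := by field_simp
    rw [e, Real.mul_rpow (by linarith) (inv_nonneg.2 hT0.le), Real.inv_rpow hT0.le, ← Real.rpow_neg hT0.le, ← mul_assoc]
    exact hTη
  have key := stub_swirlComparison K lam K' w hlam hK' hwc hw2 hw0 hwK hw1 hwineq W hW hax t' t ht' ht y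
  calc |swirl (W t) y| ≤ K * K' * (t / t') ^ lam * w (cylRadius y / Real.sqrt (-t)) := key
    _ = K * K' * w (cylRadius y / Real.sqrt (-t)) * (t / t') ^ lam := by ring
    _ ≤ η := hle
    _ ≤ 0 + η := by rw [zero_add]

/-- **R5″ — AXISYMMETRIC TYPE-I ANCIENT MILD FIELDS VANISH (no decay hypothesis).**  For `W ∈ 𝒜_K` (`IsTypeIAncientMild K W`) with
every slice `W τ`, `τ < 0`, axisymmetric about the `x₃`-axis: `W ≡ 0` on `τ < 0`.  Swirl extinction (`hasNoSwirl_of_isAxisymmetric`)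
followed by the landed no-swirl Liouville step `stub_noSwirlLiouville` (KNSS 2009 Thm 5.2 on bounded time shifts).  This is the
integrated-hypothesis form of the CLOSED crux `AxisymEndLiouville` (`Theorems.AxisymEndLiouville_of`, stmt-14061, route
SymmetryModuliCount); it removes the hypothesis `∃ C, r‖W τ x‖ ≤ C` from rung R5 of LINE g9-β.
[cite: KochNadirashviliSereginSverak2009, Thm 5.2 (arXiv:0709.3599 §5)] -/
theorem eq_zero_of_isAxisymmetric {K : ℝ} {W : ℝ → EuclideanSpace ℝ (Fin 3) → EuclideanSpace ℝ (Fin 3)}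
    (hW : IsTypeIAncientMild K W) (hax : ∀ τ : ℝ, τ < 0 → IsAxisymmetric (W τ)) :
    ∀ τ : ℝ, τ < 0 → ∀ x, W τ x = 0 :=
  stub_noSwirlLiouville K W hW hax (hasNoSwirl_of_isAxisymmetric hW hax)

/-- **One axisymmetric slice suffices.**  `W ∈ 𝒜_K` with ONE slice `W τ₁` (`τ₁ < 0`) axisymmetric about the `x₃`-axis vanishes
identically on `τ < 0`: eternal symmetry (`isAxisymmetric_of_isAxisymmetric_slice`: forward by uniqueness of bounded Oseen-mild
solutions, backward by time analyticity) and `eq_zero_of_isAxisymmetric`.  Supersedes `eq_zero_of_isAxisymmetric_slice` (same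
statement with the idle decay hypothesis). [cite: LemarieRieusset2016, Thm. 9.12 (PDF p. 260)] -/
theorem eq_zero_of_isAxisymmetric_oneSlice {K : ℝ} {W : ℝ → EuclideanSpace ℝ (Fin 3) → EuclideanSpace ℝ (Fin 3)}
    (hW : IsTypeIAncientMild K W) {τ₁ : ℝ} (hτ₁ : τ₁ < 0) (hax : IsAxisymmetric (W τ₁)) :
    ∀ τ : ℝ, τ < 0 → ∀ x, W τ x = 0 :=
  eq_zero_of_isAxisymmetric hW (isAxisymmetric_of_isAxisymmetric_slice hW hτ₁ hax)

/-! ### Any axis: conjugation by an affine isometry `x ↦ L x + b` -/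

/-- The conjugate `V τ x = L⁻¹ (W τ (L x + b))` of `W ∈ 𝒜_K` by the affine isometry `x ↦ L x + b` lies in `𝒜_K`
(translation covariance `IsTypeIAncientMild.comp_add_right`, isometry covariance `isTypeIAncientMild_conj_linearIsometryEquiv`).
[cite: KochNadirashviliSereginSverak2009, §1 (1.2) (arXiv:0709.3599 p. 3)] -/
theorem isTypeIAncientMild_conj_affine {K : ℝ} {W : ℝ → EuclideanSpace ℝ (Fin 3) → EuclideanSpace ℝ (Fin 3)}
    (hW : IsTypeIAncientMild K W) (L : EuclideanSpace ℝ (Fin 3) ≃ₗᵢ[ℝ] EuclideanSpace ℝ (Fin 3)) (b : EuclideanSpace ℝ (Fin 3)) :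
    IsTypeIAncientMild K (fun τ x => L.symm (W τ (L x + b))) := by
  have h1 : IsTypeIAncientMild K (fun τ x => W τ (x + b)) := IsTypeIAncientMild.comp_add_right hW b
  have h2 := isTypeIAncientMild_conj_linearIsometryEquiv h1 L.symm
  simpa only [LinearIsometryEquiv.symm_symm] using h2

/-- **Any axis, all slices.**  If every slice of `W ∈ 𝒜_K` is axisymmetric about the axis `{L (s e₃) + b : s ∈ ℝ}` — i.e. the
conjugate field `x ↦ L⁻¹ (W τ (L x + b))` is `IsAxisymmetric` for every `τ < 0` — then `W ≡ 0` on `τ < 0`.  (For an axis given by a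
skew generator `A` and a centre `c` use the closed crux `Theorems.AxisymEndLiouville_of` directly.) [folklore] -/
theorem eq_zero_of_conj_isAxisymmetric {K : ℝ} {W : ℝ → EuclideanSpace ℝ (Fin 3) → EuclideanSpace ℝ (Fin 3)}
    (hW : IsTypeIAncientMild K W) (L : EuclideanSpace ℝ (Fin 3) ≃ₗᵢ[ℝ] EuclideanSpace ℝ (Fin 3)) (b : EuclideanSpace ℝ (Fin 3))
    (hax : ∀ τ : ℝ, τ < 0 → IsAxisymmetric (fun x => L.symm (W τ (L x + b)))) :
    ∀ τ : ℝ, τ < 0 → ∀ x, W τ x = 0 := by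
  intro τ hτ x
  have hV := eq_zero_of_isAxisymmetric (isTypeIAncientMild_conj_affine hW L b) hax τ hτ (L.symm (x - b))
  have e : L (L.symm (x - b)) + b = x := by rw [L.apply_symm_apply, sub_add_cancel]
  simp only [e] at hV
  simpa using congrArg L hV

/-- **Any axis, one slice.**  If ONE slice `W τ₁` (`τ₁ < 0`) of `W ∈ 𝒜_K` is axisymmetric about the axis `{L (s e₃) + b}`, then
`W ≡ 0` on `τ < 0` (`eq_zero_of_isAxisymmetric_oneSlice` for the conjugate field). [folklore] -/
theorem eq_zero_of_conj_isAxisymmetric_oneSlice {K : ℝ} {W : ℝ → EuclideanSpace ℝ (Fin 3) → EuclideanSpace ℝ (Fin 3)}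
    (hW : IsTypeIAncientMild K W) (L : EuclideanSpace ℝ (Fin 3) ≃ₗᵢ[ℝ] EuclideanSpace ℝ (Fin 3)) (b : EuclideanSpace ℝ (Fin 3))
    {τ₁ : ℝ} (hτ₁ : τ₁ < 0) (hax : IsAxisymmetric (fun x => L.symm (W τ₁ (L x + b)))) :
    ∀ τ : ℝ, τ < 0 → ∀ x, W τ x = 0 := by
  intro τ hτ x
  have hV := eq_zero_of_isAxisymmetric_oneSlice (isTypeIAncientMild_conj_affine hW L b) hτ₁ hax τ hτ (L.symm (x - b))
  have e : L (L.symm (x - b)) + b = x := by rw [L.apply_symm_apply, sub_add_cancel]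
  simp only [e] at hV
  simpa using congrArg L hV

/-! ### The necklace corollaries (heart H′ of LINE g9-β, axisymmetric case, no decay / growth hypothesis) -/

/-- The zero field is not a tube slice (its `Ḣ¹`/`Ḣ²` budgets are finite). [folklore] -/
theorem not_isTubeSlice_zero : ¬ IsTubeSlice (fun _ : EuclideanSpace ℝ (Fin 3) => (0 : EuclideanSpace ℝ (Fin 3))) := by
  intro h
  apply h.2.2.2.1
  have e : (fun _ : EuclideanSpace ℝ (Fin 3) => (0 : EuclideanSpace ℝ (Fin 3))) = 0 := rfl
  rw [e]
  refine ⟨?_, ?_⟩ <;> simp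

/-- **H′, axisymmetric case, all slices (no decay, no growth hypothesis).**  A Type-I ancient mild field all of whose slices are
axisymmetric about the `x₃`-axis has no tube slice at any time — it is zero.  Supersedes the workfile corollary
`noFilamentTubeSliceAllTime_axisymmetric` (rev 10), which needed `∃ C, r‖W τ x‖ ≤ C`. [folklore] -/
theorem not_isTubeSlice_of_isAxisymmetric {K : ℝ} {W : ℝ → EuclideanSpace ℝ (Fin 3) → EuclideanSpace ℝ (Fin 3)}
    (hW : IsTypeIAncientMild K W) (hax : ∀ τ : ℝ, τ < 0 → IsAxisymmetric (W τ)) {s : ℝ} (hs : s < 0) :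
    ¬ IsTubeSlice (W s) := by
  have h0 : W s = fun _ => 0 := funext fun x => eq_zero_of_isAxisymmetric hW hax s hs x
  rw [h0]
  exact not_isTubeSlice_zero

/-- **H′, axisymmetric case, one slice.**  A Type-I ancient mild field with ONE axisymmetric slice (`τ₁ < 0`, about the `x₃`-axis)
has no tube slice at any time `s < 0`. [folklore] -/
theorem not_isTubeSlice_of_isAxisymmetric_oneSlice {K : ℝ} {W : ℝ → EuclideanSpace ℝ (Fin 3) → EuclideanSpace ℝ (Fin 3)}
    (hW : IsTypeIAncientMild K W) {τ₁ : ℝ} (hτ₁ : τ₁ < 0) (hax : IsAxisymmetric (W τ₁)) {s : ℝ} (hs : s < 0) :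
    ¬ IsTubeSlice (W s) :=
  not_isTubeSlice_of_isAxisymmetric hW (isAxisymmetric_of_isAxisymmetric_slice hW hτ₁ hax) hs

/-- **H′, axisymmetric case, any axis, one slice.**  A Type-I ancient mild field with ONE slice axisymmetric about SOME axis
`{L (s e₃) + b}` has no tube slice at any time `s < 0`: necklace brief item (f) in full — a counterexample to H′ has no slice
axisymmetric about any axis. [folklore] -/
theorem not_isTubeSlice_of_conj_isAxisymmetric_oneSlice {K : ℝ} {W : ℝ → EuclideanSpace ℝ (Fin 3) → EuclideanSpace ℝ (Fin 3)}
    (hW : IsTypeIAncientMild K W) (L : EuclideanSpace ℝ (Fin 3) ≃ₗᵢ[ℝ] EuclideanSpace ℝ (Fin 3)) (b : EuclideanSpace ℝ (Fin 3))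
    {τ₁ : ℝ} (hτ₁ : τ₁ < 0) (hax : IsAxisymmetric (fun x => L.symm (W τ₁ (L x + b)))) {s : ℝ} (hs : s < 0) :
    ¬ IsTubeSlice (W s) := by
  have h0 : W s = fun _ => 0 := funext fun x => eq_zero_of_conj_isAxisymmetric_oneSlice hW L b hτ₁ hax s hs x
  rw [h0]
  exact not_isTubeSlice_zero

/-- **The workfile's rung R5 `AxisymmetricTubeLiouville` WITHOUT its decay hypothesis**, in the rung's explicit-binder shape
(`∀ K W, IsTypeIAncientMild K W → (∀ τ < 0, IsAxisymmetric (W τ)) → ∀ τ < 0, ∀ x, W τ x = 0`), for citation by name in the crux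
workfile. [folklore] -/
theorem axisymmetricTypeILiouville :
    ∀ (K : ℝ) (W : ℝ → EuclideanSpace ℝ (Fin 3) → EuclideanSpace ℝ (Fin 3)), IsTypeIAncientMild K W →
      (∀ τ : ℝ, τ < 0 → IsAxisymmetric (W τ)) → ∀ τ : ℝ, τ < 0 → ∀ x, W τ x = 0 :=
  fun _ _ hW hax => eq_zero_of_isAxisymmetric hW hax

end NearExtremalTransiencePerFlow.FilamentSelection

end Summit.NavierStokesRegularity.NavierStokesRegularity.Theorems

end
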